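import Mathlib.LinearAlgebra.Trace
import Mathlib.LinearAlgebra.Determinant
import Mathlib.LinearAlgebra.Matrix.ToLin
import Mathlib.LinearAlgebra.Matrix.Trace
import Mathlib.Data.ZMod.Basic
import Mathlib.Tactic.FinCases
import HarnessLib

/-!
# The `GL₂(F_3)` lemma behind the non-emptiness of the Chebotarev class of
# `stub_chebotarevSupplyAtThree` (crux 19109, line `inert`): traces of `r u^j s`

Crux `stmt-BirchSwinnertonDyer-19109` (`EulerHalvesAtThree`), line `inert` (tam3-p1 g18, skeleton r19),
registered stub `stub_chebotarevSupplyAtThree`.  Its hand proof (card `Lines/inert.md` r19) realises the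
Frobenius class by `σ = c₀ · ã^j · [x̃, ỹ]` (complex conjugation, a Kummer generator, a commutator of
lifts of two elements of `GL₂(F_3)` under the surjective mod-3 representation); the trace of `ρ̄_{E,3}(σ)`
is `tr(r u^j s)` with `r = ρ̄(c₀)` an INVOLUTION, `u = ρ̄(ã)` ARBITRARY invertible and `s = [x, y]` at our
disposal, while `j ∈ ℤ/3` must avoid ONE residue class (the one killing the Kummer condition).  This file
proves the finite-group fact that makes the choice possible, by exhaustion over `F_3` (kernel `decide` on
the `3^8` coordinate tuples, after `simp` has turned `2 × 2` matrix traces into polynomials):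

* `ChebSupply.game_fin_two` — in coordinates: if `r = (a b; c d)` satisfies `r² = 1` and
  `u = (e f; g h)` is invertible, then one of `s₁ = (1 1; 0 1)`, `s₂ = (1 0; 1 1)`, `s₃ = (2 1; 1 1)` has
  `tr(r u^j s) = 0` for AT MOST ONE `j ∈ {0, 1, 2}` (stated: two of the three traces are non-zero);
* `ChebSupply.exists_stock_trace_ne_zero` — the same for `r u : Matrix (Fin 2) (Fin 2) (ZMod 3)`;
* `ChebSupply.stock₁_eq_comm`, `stock₂_eq_comm`, `stock₃_eq_comm` — each `sᵢ` IS a commutator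
  `x y x⁻¹ y⁻¹` of explicit invertible matrices (`s₁ = [diag(2,1), s₁]`, `s₂ = [diag(1,2), s₂]`,
  `s₃ = [s₁, (0 1; 2 0)]`, inverses displayed), so `[x̃, ỹ]` realises it under a surjective representation;
* `ChebSupply.exists_stock_trace_ne_zero_end` — the statement for endomorphisms of a `ZMod 3`-module
  with a basis indexed by `Fin 2` (transport along `LinearMap.toMatrix`), the form used on `E[3]`.

Pure finite linear algebra; no elliptic curve enters; no definition is introduced.  HONEST FRAMING: a
helper toward one registered stub of one line of crux 19109; BSD is proved for no curve here.

## References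

* J.-P. Serre, *Propriétés galoisiennes des points d'ordre fini des courbes elliptiques*, Invent.
  Math. 15 (1972), §2 (the groups `GL₂(F_p)`). [Serre1972]

## Mathlib / tree search

Mathlib: `Matrix.trace_fin_two`, `Matrix.mul_apply`, `Fin.sum_univ_two`, `Matrix.eta_fin_two`,
`Matrix.det_fin_two`, `Matrix.one_apply`, `LinearMap.toMatrix_mul`, `LinearMap.toMatrix_one`,
`LinearMap.trace_eq_matrix_trace`, `LinearMap.toMatrix_toLin`, `LinearMap.det_toMatrix`, `decide`.
`lean search 'ZMod 3.*trace|trace.*ZMod 3'` (2026-08-28): corner3-p2's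
`…CornerAtThreeFrobeniusTraceTwoModThree` (order `8` ⟺ `det = −1 ∧ tr ≠ 0`), nothing on `tr(r u^j s)`.
-/

set_option autoImplicit false
set_option linter.dupNamespace false

namespace Summit.BirchSwinnertonDyer.BirchSwinnertonDyer.Theorems.ChebSupply

open Matrix

/-! ## §1 The game in coordinates -/

set_option maxHeartbeats 4000000 in
set_option maxRecDepth 20000 in
set_option synthInstance.maxHeartbeats 2000000 in
set_option synthInstance.maxSize 100000 in
/-- **The `GL₂(F_3)` game in coordinates**: for `r = (a b; c d)` with `r² = 1` and `u = (e f; g h)`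
invertible, one of `s ∈ {(1 1; 0 1), (1 0; 1 1), (2 1; 1 1)}` has two of the three traces
`tr(r s)`, `tr(r u s)`, `tr(r u² s)` non-zero (exhaustion over `F_3^8`). [folklore] -/
theorem game_fin_two (a b c d e f g h : ZMod 3)
    (h₁ : a * a + b * c = 1) (h₂ : a * b + b * d = 0) (h₃ : c * a + d * c = 0) (h₄ : c * b + d * d = 1)
    (hu : e * h - f * g ≠ 0) :
    ((((!![a, b; c, d] * !![1, 1; 0, 1] : Matrix (Fin 2) (Fin 2) (ZMod 3)).trace) ≠ 0 ∧ ((!![a, b; c, d] * !![e, f; g, h] * !![1, 1; 0, 1] : Matrix (Fin 2) (Fin 2) (ZMod 3)).trace) ≠ 0) ∨ (((!![a, b; c, d] * !![1, 1; 0, 1] : Matrix (Fin 2) (Fin 2) (ZMod 3)).trace) ≠ 0 ∧ ((!![a, b; c, d] * !![e, f; g, h] * !![e, f; g, h] * !![1, 1; 0, 1] : Matrix (Fin 2) (Fin 2) (ZMod 3)).trace) ≠ 0) ∨ (((!![a, b; c, d] * !![e, f; g, h] * !![1, 1; 0, 1] : Matrix (Fin 2) (Fin 2) (ZMod 3)).trace)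 ≠ 0 ∧ ((!![a, b; c, d] * !![e, f; g, h] * !![e, f; g, h] * !![1, 1; 0, 1] : Matrix (Fin 2) (Fin 2) (ZMod 3)).trace) ≠ 0)) ∨
    ((((!![a, b; c, d] * !![1, 0; 1, 1] : Matrix (Fin 2) (Fin 2) (ZMod 3)).trace) ≠ 0 ∧ ((!![a, b; c, d] * !![e, f; g, h] * !![1, 0; 1, 1] : Matrix (Fin 2) (Fin 2) (ZMod 3)).trace) ≠ 0) ∨ (((!![a, b; c, d] * !![1, 0; 1, 1] : Matrix (Fin 2) (Fin 2) (ZMod 3)).trace) ≠ 0 ∧ ((!![a, b; c, d] * !![e, f; g, h] * !![e, f; g, h] * !![1, 0; 1, 1] : Matrix (Fin 2) (Fin 2) (ZMod 3)).trace) ≠ 0) ∨ (((!![a, b; c, d] * !![e, f; g, h] * !![1, 0; 1, 1] : Matrix (Fin 2) (Fin 2) (ZMod 3)).trace) ≠ 0 ∧ ((!![a, b; c, d] * !![e, f; g, h] * !![e, f; g, h] * !![1, 0; 1, 1] : Matrix (Fin 2) (Fin 2) (ZMod 3)).trace) ≠ 0)) ∨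
    ((((!![a, b; c, d] * !![2, 1; 1, 1] : Matrix (Fin 2) (Fin 2) (ZMod 3)).trace) ≠ 0 ∧ ((!![a, b; c, d] * !![e, f; g, h] * !![2, 1; 1, 1] : Matrix (Fin 2) (Fin 2) (ZMod 3)).trace) ≠ 0) ∨ (((!![a, b; c, d] * !![2, 1; 1, 1] : Matrix (Fin 2) (Fin 2) (ZMod 3)).trace) ≠ 0 ∧ ((!![a, b; c, d] * !![e, f; g, h] * !![e, f; g, h] * !![2, 1; 1, 1] : Matrix (Fin 2) (Fin 2) (ZMod 3)).trace) ≠ 0) ∨ (((!![a, b; c, d] * !![e, f; g, h] * !![2, 1; 1, 1] : Matrix (Fin 2) (Fin 2) (ZMod 3)).trace) ≠ 0 ∧ ((!![a, b; c, d] * !![e, f; g, h] * !![e, f; g, h] * !![2, 1; 1, 1] : Matrix (Fin 2) (Fin 2) (ZMod 3)).trace) ≠ 0)) := by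
  simp only [Matrix.trace_fin_two, Matrix.mul_apply, Fin.sum_univ_two, Matrix.of_apply, Matrix.cons_val',
    Matrix.cons_val_zero, Matrix.cons_val_one, Matrix.empty_val', Matrix.cons_val_fin_one]
  revert a b c d e f g h
  decide

/-! ## §2 Matrices -/

/-- **The `GL₂(F_3)` game for matrices**: if `r * r = 1` and `u` is invertible then one of
`s ∈ {(1 1; 0 1), (1 0; 1 1), (2 1; 1 1)}` has two of `tr(r s)`, `tr(r u s)`, `tr(r u u s)` non-zero —
i.e. `tr(r u^j s) = 0` for at most one `j ∈ ℤ/3`. [folklore] -/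
theorem exists_stock_trace_ne_zero (r u : Matrix (Fin 2) (Fin 2) (ZMod 3)) (hr : r * r = 1) (hu : u.det ≠ 0) :
    ((((r * !![1, 1; 0, 1] : Matrix (Fin 2) (Fin 2) (ZMod 3)).trace) ≠ 0 ∧ ((r * u * !![1, 1; 0, 1] : Matrix (Fin 2) (Fin 2) (ZMod 3)).trace) ≠ 0) ∨ (((r * !![1, 1; 0, 1] : Matrix (Fin 2) (Fin 2) (ZMod 3)).trace) ≠ 0 ∧ ((r * u * u * !![1, 1; 0, 1] : Matrix (Fin 2) (Fin 2) (ZMod 3)).trace) ≠ 0) ∨ (((r * u * !![1, 1; 0, 1] : Matrix (Fin 2) (Fin 2) (ZMod 3)).trace) ≠ 0 ∧ ((r * u * u * !![1, 1; 0, 1] : Matrix (Fin 2) (Fin 2) (ZMod 3)).trace) ≠ 0)) ∨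
    ((((r * !![1, 0; 1, 1] : Matrix (Fin 2) (Fin 2) (ZMod 3)).trace) ≠ 0 ∧ ((r * u * !![1, 0; 1, 1] : Matrix (Fin 2) (Fin 2) (ZMod 3)).trace) ≠ 0) ∨ (((r * !![1, 0; 1, 1] : Matrix (Fin 2) (Fin 2) (ZMod 3)).trace) ≠ 0 ∧ ((r * u * u * !![1, 0; 1, 1] : Matrix (Fin 2) (Fin 2) (ZMod 3)).trace) ≠ 0) ∨ (((r * u * !![1, 0; 1, 1] : Matrix (Fin 2) (Fin 2) (ZMod 3)).trace) ≠ 0 ∧ ((r * u * u * !![1, 0; 1, 1] : Matrix (Fin 2) (Fin 2) (ZMod 3)).trace) ≠ 0)) ∨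
    ((((r * !![2, 1; 1, 1] : Matrix (Fin 2) (Fin 2) (ZMod 3)).trace) ≠ 0 ∧ ((r * u * !![2, 1; 1, 1] : Matrix (Fin 2) (Fin 2) (ZMod 3)).trace) ≠ 0) ∨ (((r * !![2, 1; 1, 1] : Matrix (Fin 2) (Fin 2) (ZMod 3)).trace) ≠ 0 ∧ ((r * u * u * !![2, 1; 1, 1] : Matrix (Fin 2) (Fin 2) (ZMod 3)).trace) ≠ 0) ∨ (((r * u * !![2, 1; 1, 1] : Matrix (Fin 2) (Fin 2) (ZMod 3)).trace) ≠ 0 ∧ ((r * u * u * !![2, 1; 1, 1] : Matrix (Fin 2) (Fin 2) (ZMod 3)).trace) ≠ 0)) := by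
  have hre := Matrix.eta_fin_two r
  have hue := Matrix.eta_fin_two u
  have hent : ∀ i j : Fin 2, (r * r) i j = (1 : Matrix (Fin 2) (Fin 2) (ZMod 3)) i j := fun i j => by rw [hr]
  have h00 := hent 0 0
  have h01 := hent 0 1
  have h10 := hent 1 0
  have h11 := hent 1 1
  simp only [Matrix.mul_apply, Fin.sum_univ_two, Matrix.one_apply_eq, Matrix.one_apply_ne (by decide : (0 : Fin 2) ≠ 1),
    Matrix.one_apply_ne (by decide : (1 : Fin 2) ≠ 0)] at h00 h01 h10 h11
  rw [Matrix.det_fin_two] at hu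
  rw [hre, hue]
  exact game_fin_two (r 0 0) (r 0 1) (r 1 0) (r 1 1) (u 0 0) (u 0 1) (u 1 0) (u 1 1) h00 h01 h10 h11 hu

/-- **`(1 1; 0 1)` is a commutator** `x y x⁻¹ y⁻¹` with `x = diag(2, 1)`, `y = (1 1; 0 1)` (inverses
displayed and checked). [folklore] -/
theorem stock₁_eq_comm :
    (!![2, 0; 0, 1] * !![1, 1; 0, 1] * !![2, 0; 0, 1] * !![1, 2; 0, 1] : Matrix (Fin 2) (Fin 2) (ZMod 3)) = !![1, 1; 0, 1] ∧
      (!![2, 0; 0, 1] * !![2, 0; 0, 1] : Matrix (Fin 2) (Fin 2) (ZMod 3)) = 1 ∧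
      (!![1, 1; 0, 1] * !![1, 2; 0, 1] : Matrix (Fin 2) (Fin 2) (ZMod 3)) = 1 ∧ (!![1, 2; 0, 1] * !![1, 1; 0, 1] : Matrix (Fin 2) (Fin 2) (ZMod 3)) = 1 := by
  refine ⟨?_, ?_, ?_, ?_⟩ <;> decide

/-- **`(1 0; 1 1)` is a commutator** `x y x⁻¹ y⁻¹` with `x = diag(1, 2)`, `y = (1 0; 1 1)`. [folklore] -/
theorem stock₂_eq_comm :
    (!![1, 0; 0, 2] * !![1, 0; 1, 1] * !![1, 0; 0, 2] * !![1, 0; 2, 1] : Matrix (Fin 2) (Fin 2) (ZMod 3)) = !![1, 0; 1, 1] ∧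
      (!![1, 0; 0, 2] * !![1, 0; 0, 2] : Matrix (Fin 2) (Fin 2) (ZMod 3)) = 1 ∧
      (!![1, 0; 1, 1] * !![1, 0; 2, 1] : Matrix (Fin 2) (Fin 2) (ZMod 3)) = 1 ∧ (!![1, 0; 2, 1] * !![1, 0; 1, 1] : Matrix (Fin 2) (Fin 2) (ZMod 3)) = 1 := by
  refine ⟨?_, ?_, ?_, ?_⟩ <;> decide

/-- **`(2 1; 1 1)` is a commutator** `x y x⁻¹ y⁻¹` with `x = (1 1; 0 1)`, `y = (0 1; 2 0)`. [folklore] -/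
theorem stock₃_eq_comm :
    (!![1, 1; 0, 1] * !![0, 1; 2, 0] * !![1, 2; 0, 1] * !![0, 2; 1, 0] : Matrix (Fin 2) (Fin 2) (ZMod 3)) = !![2, 1; 1, 1] ∧
      (!![1, 1; 0, 1] * !![1, 2; 0, 1] : Matrix (Fin 2) (Fin 2) (ZMod 3)) = 1 ∧ (!![1, 2; 0, 1] * !![1, 1; 0, 1] : Matrix (Fin 2) (Fin 2) (ZMod 3)) = 1 ∧
      (!![0, 1; 2, 0] * !![0, 2; 1, 0] : Matrix (Fin 2) (Fin 2) (ZMod 3)) = 1 ∧ (!![0, 2; 1, 0] * !![0, 1; 2, 0] : Matrix (Fin 2) (Fin 2) (ZMod 3)) = 1 := by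
  refine ⟨?_, ?_, ?_, ?_, ?_⟩ <;> decide

/-! ## §3 Endomorphisms of a `ZMod 3`-module with a basis indexed by `Fin 2` -/

section End

variable {V : Type*} [AddCommGroup V] [Module (ZMod 3) V] (b : Module.Basis (Fin 2) (ZMod 3) V)

/-- **The `GL₂(F_3)` game for endomorphisms of `E[3] ≅ F_3²`**: if `R ∘ R = id` and `U` is invertible
then one of the endomorphisms `S` with matrix `(1 1; 0 1)`, `(1 0; 1 1)`, `(2 1; 1 1)` in the basis `b`
has two of `tr(R S)`, `tr(R U S)`, `tr(R U U S)` non-zero. [folklore] -/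
theorem exists_stock_trace_ne_zero_end (R U : Module.End (ZMod 3) V) (hR : R * R = 1)
    (hU : LinearMap.det U ≠ 0) :
    (((LinearMap.trace (ZMod 3) V (R * (Matrix.toLin b b !![1, 1; 0, 1]))) ≠ 0 ∧ (LinearMap.trace (ZMod 3) V (R * U * (Matrix.toLin b b !![1, 1; 0, 1]))) ≠ 0) ∨ ((LinearMap.trace (ZMod 3) V (R * (Matrix.toLin b b !![1, 1; 0, 1]))) ≠ 0 ∧ (LinearMap.trace (ZMod 3) V (R * U * U * (Matrix.toLin b b !![1, 1; 0, 1]))) ≠ 0) ∨ ((LinearMap.trace (ZMod 3) V (R * U * (Matrix.toLin b b !![1, 1; 0, 1]))) ≠ 0 ∧ (LinearMap.trace (ZMod 3) V (R * U * U * (Matrix.toLin b b !![1, 1; 0, 1]))) ≠ 0)) ∨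
    (((LinearMap.trace (ZMod 3) V (R * (Matrix.toLin b b !![1, 0; 1, 1]))) ≠ 0 ∧ (LinearMap.trace (ZMod 3) V (R * U * (Matrix.toLin b b !![1, 0; 1, 1]))) ≠ 0) ∨ ((LinearMap.trace (ZMod 3) V (R * (Matrix.toLin b b !![1, 0; 1, 1]))) ≠ 0 ∧ (LinearMap.trace (ZMod 3) V (R * U * U * (Matrix.toLin b b !![1, 0; 1, 1]))) ≠ 0) ∨ ((LinearMap.trace (ZMod 3) V (R * U * (Matrix.toLin b b !![1, 0; 1, 1]))) ≠ 0 ∧ (LinearMap.trace (ZMod 3) V (R * U * U * (Matrix.toLin b b !![1, 0; 1, 1]))) ≠ 0)) ∨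
    (((LinearMap.trace (ZMod 3) V (R * (Matrix.toLin b b !![2, 1; 1, 1]))) ≠ 0 ∧ (LinearMap.trace (ZMod 3) V (R * U * (Matrix.toLin b b !![2, 1; 1, 1]))) ≠ 0) ∨ ((LinearMap.trace (ZMod 3) V (R * (Matrix.toLin b b !![2, 1; 1, 1]))) ≠ 0 ∧ (LinearMap.trace (ZMod 3) V (R * U * U * (Matrix.toLin b b !![2, 1; 1, 1]))) ≠ 0) ∨ ((LinearMap.trace (ZMod 3) V (R * U * (Matrix.toLin b b !![2, 1; 1, 1]))) ≠ 0 ∧ (LinearMap.trace (ZMod 3) V (R * U * U * (Matrix.toLin b b !![2, 1; 1, 1]))) ≠ 0)) := by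
  have key := exists_stock_trace_ne_zero (LinearMap.toMatrix b b R) (LinearMap.toMatrix b b U)
    (by rw [← LinearMap.toMatrix_mul, hR, LinearMap.toMatrix_one])
    (by rw [LinearMap.det_toMatrix]; exact hU)
  simp only [LinearMap.trace_eq_matrix_trace (ZMod 3) b, LinearMap.toMatrix_mul, LinearMap.toMatrix_toLin]
  exact key

end End

end Summit.BirchSwinnertonDyer.BirchSwinnertonDyer.Theorems.ChebSupply
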